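/- Fleet lead `ym-wcr-19456-p1`, route `WeakCouplingRates`, crux `ColdBoxTwoPointFloorW` (stmt-QuantumFields-19608). -/
import Summits.QuantumFields.YangMills.Theorems.WeakCouplingRatesColdBoxGnomonic

/-!
# Crux `ColdBoxTwoPointFloor(W)`, piece S3c-ii step 4 (chart) dictionary: the UPPER-HEMISPHERE Haar formula, chart coordinate vs cost,
# the single-link quartic remainder, and the gnomonic Jacobian as a tilt

* `trace_re_quatToSU2_neg_gnomonic(_neg)` — the lower hemisphere has negative trace, `Re tr P(−(1,v)) = −2/√(1+|v|²) < 0`;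
* **`lintegral_haarProbability_su2_gnomonic_upper`** — for measurable `F ≥ 0` vanishing where `Re tr U ≤ 0` (any integrand supported
  near the identity, e.g. after the small-field/Poincaré restriction): `∫F dHaar = (2π²)⁻¹∫_{ℝ³} F(P(1,v))(1+|v|²)⁻² dv` — the one-term form of
  the tree's `lintegral_haarProbability_su2_gnomonic`, to be applied link by link (Fubini) in step (a) of the assembly;
* `sum_sq_le_two_mul_cost` — `cost ≤ ½ ⇒ |v|² ≤ 2·cost` (chart coordinates are controlled by the Wilson cost, hence by `ell_le_uniform`);
* `abs_cost_sub_sum_sq_le` — `|cost − |v|²| ≤ |v|⁴` (single-link quartic remainder);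
* `abs_log_gnomonicDensity_le` — `|log (1+s)⁻²| ≤ 2s`: the Haar density contributes `≤ 2|v_e|²` per link to the sup-norm of the tilt `W`.
Everything proved; no definition; standard axioms.
-/

set_option autoImplicit false

noncomputable section

open MeasureTheory Quaternion
open scoped ENNReal
open Literature.MathematicalPhysics.QuantumLattice

namespace Summit.QuantumFields.YangMills.Theorems.WeakCouplingRates

/-- The lower hemisphere has NEGATIVE trace: `Re tr P(−(1,v)) = −2/√(1+|v|²) < 0`. -/
theorem trace_re_quatToSU2_neg_gnomonic (v : Fin 3 → ℝ) :
    (((quatToSU2 (-gnomonicQuat v) : Matrix.specialUnitaryGroup (Fin 2) ℂ) : Matrix (Fin 2) (Fin 2) ℂ).trace).re =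
      -(2 / Real.sqrt (1 + ∑ i, v i ^ 2)) := by
  have hne : -gnomonicQuat v ≠ 0 := neg_ne_zero.2 (gnomonicQuat_ne_zero v)
  rw [trace_quatToSU2_re hne, norm_neg, norm_gnomonicQuat]
  simp [gnomonicQuat, div_eq_mul_inv]

/-- … in particular it is `< 0`. -/
theorem trace_re_quatToSU2_neg_gnomonic_neg (v : Fin 3 → ℝ) :
    (((quatToSU2 (-gnomonicQuat v) : Matrix.specialUnitaryGroup (Fin 2) ℂ) : Matrix (Fin 2) (Fin 2) ℂ).trace).re < 0 := by
  rw [trace_re_quatToSU2_neg_gnomonic]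
  have : 0 < Real.sqrt (1 + ∑ i, v i ^ 2) := Real.sqrt_pos.2 (by positivity)
  have : 0 < 2 / Real.sqrt (1 + ∑ i, v i ^ 2) := by positivity
  linarith

/-- **Upper-hemisphere Haar formula**: for a measurable `F ≥ 0` vanishing where `Re tr U ≤ 0` (e.g. supported near the identity),
`∫ F dHaar_{SU(2)} = (2π²)⁻¹ ∫_{ℝ³} F(P(1,v)) (1+|v|²)⁻² dv` — the one-term form of the tree's two-hemisphere formula
`lintegral_haarProbability_su2_gnomonic` used link by link in the one-scale expansion. -/
theorem lintegral_haarProbability_su2_gnomonic_upper (F : Matrix.specialUnitaryGroup (Fin 2) ℂ → ℝ≥0∞) (hF : Measurable F)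
    (hsupp : ∀ U : Matrix.specialUnitaryGroup (Fin 2) ℂ, ((U : Matrix (Fin 2) (Fin 2) ℂ).trace).re ≤ 0 → F U = 0) :
    ∫⁻ U, F U ∂(Literature.MathematicalPhysics.QuantumFieldTheory.haarProbability (Matrix.specialUnitaryGroup (Fin 2) ℂ)) =
      ENNReal.ofReal (1 / (2 * Real.pi ^ 2)) *
        ∫⁻ v : Fin 3 → ℝ, F (quatToSU2 (gnomonicQuat v)) * ENNReal.ofReal (((1 + ∑ i, v i ^ 2)⁻¹) ^ 2) := by
  rw [lintegral_haarProbability_su2_gnomonic F hF]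
  congr 1
  refine lintegral_congr fun v => ?_
  rw [hsupp _ (trace_re_quatToSU2_neg_gnomonic_neg v).le, add_zero]

/-- **Chart coordinate vs cost**: if the single-link cost is at most `½`, then `|v|² ≤ 2·(2 − Re tr P(1,v))` (from
`|v|²/(1+|v|²) ≤ cost`). -/
theorem sum_sq_le_two_mul_cost {v : Fin 3 → ℝ}
    (hc : 2 - (((quatToSU2 (gnomonicQuat v) : Matrix.specialUnitaryGroup (Fin 2) ℂ) : Matrix (Fin 2) (Fin 2) ℂ).trace).re ≤ 1 / 2) :
    ∑ i, v i ^ 2 ≤ 2 * (2 - (((quatToSU2 (gnomonicQuat v) : Matrix.specialUnitaryGroup (Fin 2) ℂ) : Matrix (Fin 2) (Fin 2) ℂ).trace).re) := by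
  have h := (two_sub_trace_re_gnomonic_bounds v).1
  set s := ∑ i, v i ^ 2 with hs
  set c := 2 - (((quatToSU2 (gnomonicQuat v) : Matrix.specialUnitaryGroup (Fin 2) ℂ) : Matrix (Fin 2) (Fin 2) ℂ).trace).re
  have hs0 : 0 ≤ s := Finset.sum_nonneg fun i _ => sq_nonneg (v i)
  rw [div_le_iff₀ (by linarith)] at h
  nlinarith

/-- **Single-link quartic remainder**: `|(2 − Re tr P(1,v)) − |v|²| ≤ |v|⁴` (from `|v|²/(1+|v|²) ≤ cost ≤ |v|²`). -/
theorem abs_cost_sub_sum_sq_le (v : Fin 3 → ℝ) :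
    |(2 - (((quatToSU2 (gnomonicQuat v) : Matrix.specialUnitaryGroup (Fin 2) ℂ) : Matrix (Fin 2) (Fin 2) ℂ).trace).re) - ∑ i, v i ^ 2|
      ≤ (∑ i, v i ^ 2) ^ 2 := by
  obtain ⟨h1, h2⟩ := two_sub_trace_re_gnomonic_bounds v
  set s := ∑ i, v i ^ 2 with hs
  have hs0 : 0 ≤ s := Finset.sum_nonneg fun i _ => sq_nonneg (v i)
  rw [div_le_iff₀ (by linarith)] at h1
  rw [abs_le]; constructor <;> nlinarith

/-- **The gnomonic Haar density as a tilt**: `|log((1+s)⁻²)| ≤ 2s` for `s ≥ 0` (per link, with `s = |v|²`: the Jacobian contributes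
at most `2|v|²` to the sup-norm of the tilt exponent). -/
theorem abs_log_gnomonicDensity_le {s : ℝ} (hs : 0 ≤ s) : |Real.log (((1 + s)⁻¹) ^ 2)| ≤ 2 * s := by
  rw [Real.log_pow, Real.log_inv]
  have h1 : 0 ≤ Real.log (1 + s) := Real.log_nonneg (by linarith)
  have h2 : Real.log (1 + s) ≤ s := by
    have := Real.add_one_le_exp s
    calc Real.log (1 + s) ≤ Real.log (Real.exp s) := Real.log_le_log (by linarith) (by linarith)
      _ = s := Real.log_exp s
  rw [abs_le]; push_cast; constructor <;> linarith

end Summit.QuantumFields.YangMills.Theorems.WeakCouplingRates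

end
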